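import Literature.AlgebraicGeometry.Deformation.SmoothSchemeLiftObstructionCechCocycleIdentity
import Literature.AlgebraicGeometry.Deformation.SmoothSchemeLiftObstructionFunctorialThreeLifts
import HarnessLib

/-!
# Functoriality of the obstruction on one triple overlap, read on REPRESENTING SECTIONS of the tangent sheaves
# (Hartshorne, *Deformation Theory*, proof of Thm. 10.2 / Remark 10.1.1; Illusie: «the obstruction is functorial»)

Layer `Literature/AlgebraicGeometry/Deformation`, namespace `Literature.AlgebraicGeometry.Deformation` (THEOREMS only: no
definition, no instance, no notation, no named fact).  The ring identity ★ `SmoothAffineDeformation.obstructionDerivation_functorial₃`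
(three chart lifts, `(g ⊗ 1)(D b) = D₁(g b) + ε_jl b + ε_lm b − ε_jm b`) read in the CURRENCY of ★ F2
`SmoothSchemeLiftObstructionCechCocycle`: a principal small extension `J ≅ k` (`e`, `t = e⁻¹ 1`), lifted transition automorphisms
inducing the identity modulo `𝔫'` (`J² = 0`, `J𝔫' = 0`), and their discrepancies REPRESENTED by sections `θ` of the tangent
sheaf: «`u(1 ⊗ c) = 1 ⊗ c + t ⊗ θ(dc)`».  For a `k`-algebra map `g : Γ(X, W) → Γ(Y, W′)` (the case of record: `g = f♯` on a
triple overlap `W = U_jlm`, `W′ = f⁻¹W`), three `A'`-algebra maps `F_j, F_l, F_m : A' ⊗_k Γ(X, W) → A' ⊗_k Γ(Y, W′)` reducing to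
`1 ⊗ g` modulo `𝔫'` (the restricted chart lifts) which intertwine the `X`- and `Y`-side transition automorphisms MODULO `J`
pair by pair, and representing sections `θ^X`, `θ^Y` of the two discrepancies:

* `exists_defectCoord` — the DEFECT COORDINATE of a pair `(F, F′)`: the unique `δ : Γ(X, W) → Γ(Y, W′)` with
  `F′(ψ(1 ⊗ c)) = φ(F(1 ⊗ c)) + t ⊗ δ(c)`; it is additive, a `g`-DERIVATION (`δ(ab) = g a · δ b + g b · δ a`, ★ `defect₂_mul`)
  and kills the constants — so ★ `HodgeTheory.exists_semilinear_lift_of_leibniz` reads it on `1`-forms;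
* **`appLE_obstruction_functorial_rep`** — THE IDENTITY ON REPRESENTING SECTIONS: for every `c ∈ Γ(X, W)`,
  `g(θ^X(dc)) = θ^Y(d(g c)) + δ_jl(c) + δ_lm(c) − δ_jm(c)`
  («`f^*[o^X] − df_*[o^Y]` is the Čech coboundary of the defect cochain», one triple overlap at a time).

Cell `hodgecm-mathlib` (D-0151), F-11 α1 / J4-(iv) road (a′) brick (iv-1b) FILE B1 (B-p08 (g16); F0P1b-plan (R34)); consumer: the Čech
bookkeeping over the principal affine cover (`SmoothSchemeLiftObstructionFunctorialCech`, per global `1`-form, in the `CechMC2`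
dialect of ★ `Morphisms/CechModuleH2`).  HC_CM is proved only modulo the 7 printed citations until rung 0 closes — nothing here
bears on a summit statement.

## References
* [Hartshorne2010] R. Hartshorne, *Deformation Theory*, GTM 257, Springer (2010): Thm. 10.2 (a) and its proof (p. 81),
  Remark 10.1.1 (p. 80), Cor. 10.3 (p. 82).
* (prose only) L. Illusie, in *FGA Explained*, AMS (2005), §8.5; F. Oort, Compositio Math. 23 (1971), §2.2.
-/

noncomputable section

-- `TopCat.Presheaf`/`Scheme.Modules` are not reducible (as in ★ F2 `SmoothSchemeLiftObstructionCechCocycle`).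
set_option backward.isDefEq.respectTransparency false

open CategoryTheory AlgebraicGeometry Opposite TopologicalSpace
open scoped TensorProduct

universe u

namespace Literature.AlgebraicGeometry.Deformation

open Literature.AlgebraicGeometry.HodgeTheory Literature.AlgebraicGeometry.Modules
  Literature.AlgebraicGeometry.Motives SmoothAffineDeformation

variable {k : Type u} [Field k] {X Y : Over (Spec (CommRingCat.of k))}
  [instΓX : ∀ W : X.left.Opens, Algebra k Γ(X.left, W)] [instΓY : ∀ W : Y.left.Opens, Algebra k Γ(Y.left, W)]
  (halgX : ∀ (W : X.left.Opens) (s : k), algebraMap k Γ(X.left, W) s = (constToPresheaf X).app (op W) s)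
  (halgY : ∀ (W : Y.left.Opens) (s : k), algebraMap k Γ(Y.left, W) s = (constToPresheaf Y).app (op W) s)
  {A' : Type u} [CommRing A'] [Algebra k A'] (J : Ideal A') (hJ : J * J = ⊥) {𝔫' : Ideal A'} (hJ𝔫 : J * 𝔫' = ⊥)
  (e : ↥(J.restrictScalars k) ≃ₗ[k] k)
  {W : X.left.Opens} {W' : Y.left.Opens} (g : Γ(X.left, W) →ₐ[k] Γ(Y.left, W'))

/-! ## §1 The defect coordinate of a pair of lifts -/

/-- A `k`-LINEAR defect: if `F′(ψ(1 ⊗ c)) − φ(F(1 ⊗ c)) ∈ J(A' ⊗ Γ(Y, W′))` for all `c`, there is a `k`-linear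
`ε : Γ(X, W) → Γ(Y, W′) ⊗_k J` with `F′(ψ(1 ⊗ c)) = φ(F(1 ⊗ c)) + ι(ε c)` (`J(A' ⊗ B) = ι(B ⊗ J)`, ★ `exists_idealTensorIncl_eq`,
and `ι` injective). [cite: Hartshorne2010, Remark 10.1.1, p. 80] -/
theorem exists_linear_defect (F F' : A' ⊗[k] Γ(X.left, W) →ₐ[A'] A' ⊗[k] Γ(Y.left, W'))
    (ψ : A' ⊗[k] Γ(X.left, W) ≃ₐ[A'] A' ⊗[k] Γ(X.left, W)) (φ : A' ⊗[k] Γ(Y.left, W') ≃ₐ[A'] A' ⊗[k] Γ(Y.left, W'))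
    (h : ∀ c : Γ(X.left, W), F' (ψ ((1 : A') ⊗ₜ c)) - φ (F ((1 : A') ⊗ₜ c)) ∈
      J • (⊤ : Submodule A' (A' ⊗[k] Γ(Y.left, W')))) :
    ∃ ε : Γ(X.left, W) →ₗ[k] Γ(Y.left, W') ⊗[k] ↥(J.restrictScalars k),
      ∀ c : Γ(X.left, W), F' (ψ ((1 : A') ⊗ₜ c)) = φ (F ((1 : A') ⊗ₜ c)) + idealTensorIncl J (ε c) := by
  have hm := fun c => exists_idealTensorIncl_eq (k := k) J (h c)
  choose m hm using hm
  have hinj := idealTensorIncl_injective (k := k) (A' := A') (B₀ := Γ(Y.left, W')) J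
  refine ⟨{ toFun := m
            map_add' := fun a b => hinj ?_
            map_smul' := fun s a => hinj ?_ }, fun c => ?_⟩
  · rw [map_add, hm, hm, hm]
    have ea : ((1 : A') ⊗ₜ[k] (a + b) : A' ⊗[k] Γ(X.left, W)) = (1 : A') ⊗ₜ a + (1 : A') ⊗ₜ b := TensorProduct.tmul_add _ _ _
    rw [ea]; simp only [map_add]; abel
  · rw [map_smul, hm, hm, RingHom.id_apply]
    have ea : ((1 : A') ⊗ₜ[k] (s • a) : A' ⊗[k] Γ(X.left, W)) = algebraMap k A' s • ((1 : A') ⊗ₜ a) := by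
      rw [algebraMap_smul, TensorProduct.tmul_smul]
    rw [ea, map_smul, map_smul, map_smul, map_smul, ← smul_sub, algebraMap_smul]
  · change F' (ψ ((1 : A') ⊗ₜ c)) = φ (F ((1 : A') ⊗ₜ c)) + idealTensorIncl J (m c)
    rw [hm]; abel

include hJ hJ𝔫 halgX in
/-- **THE DEFECT COORDINATE.**  For a pair of `A'`-algebra maps `F, F′ : A' ⊗ Γ(X, W) → A' ⊗ Γ(Y, W′)` with `F ≡ 1 ⊗ g (mod 𝔫')`
and automorphisms `ψ` (on `X`) and `φ ≡ 1 (mod 𝔫')` (on `Y`) intertwined by the pair modulo `J`, there is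
`δ : Γ(X, W) → Γ(Y, W′)` with `F′(ψ(1 ⊗ c)) = φ(F(1 ⊗ c)) + t ⊗ δ(c)`, ADDITIVE, a `g`-DERIVATION (★ `defect₂_mul`) and ZERO ON
CONSTANTS. [cite: Hartshorne2010, Remark 10.1.1, p. 80] [cite: Hartshorne2010, Thm. 10.2 (proof), p. 81] -/
theorem exists_defectCoord (F F' : A' ⊗[k] Γ(X.left, W) →ₐ[A'] A' ⊗[k] Γ(Y.left, W'))
    (hF : ∀ c : Γ(X.left, W), F ((1 : A') ⊗ₜ c) - (1 : A') ⊗ₜ g c ∈ 𝔫' • (⊤ : Submodule A' (A' ⊗[k] Γ(Y.left, W'))))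
    (ψ : A' ⊗[k] Γ(X.left, W) ≃ₐ[A'] A' ⊗[k] Γ(X.left, W)) (φ : A' ⊗[k] Γ(Y.left, W') ≃ₐ[A'] A' ⊗[k] Γ(Y.left, W'))
    (hφ : ∀ x, φ x - x ∈ 𝔫' • (⊤ : Submodule A' (A' ⊗[k] Γ(Y.left, W'))))
    (h : ∀ c : Γ(X.left, W), F' (ψ ((1 : A') ⊗ₜ c)) - φ (F ((1 : A') ⊗ₜ c)) ∈
      J • (⊤ : Submodule A' (A' ⊗[k] Γ(Y.left, W')))) :
    ∃ δ : Γ(X.left, W) → Γ(Y.left, W'),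
      (∀ c, F' (ψ ((1 : A') ⊗ₜ c)) =
        φ (F ((1 : A') ⊗ₜ c)) + ((e.symm 1 : ↥(J.restrictScalars k)) : A') ⊗ₜ δ c) ∧
      (∀ a b, δ (a + b) = δ a + δ b) ∧ (∀ a b, δ (a * b) = g a * δ b + g b * δ a) ∧
      ∀ s : k, δ ((constToPresheaf X).app (op W) s) = 0 := by
  obtain ⟨ε, hε⟩ := exists_linear_defect J F F' ψ φ h
  -- coordinates of `ε c = δ c ⊗ t`
  have hδ := fun c => (exists_eq_tmul_symm_one J e (ε c)).exists
  choose δ hδ using hδ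
  refine ⟨δ, fun c => ?_, fun a b => ?_, fun a b => ?_, fun s => ?_⟩
  · rw [hε, hδ, idealTensorIncl_tmul]
  · exact tmul_symm_one_injective J e (by rw [← hδ, map_add, hδ a, hδ b, TensorProduct.add_tmul])
  · apply tmul_symm_one_injective J e
    rw [← hδ, defect₂_mul J hJ hJ𝔫 F F' g hF ψ φ hφ ε hε a b, hδ a, hδ b, TensorProduct.smul_tmul',
      TensorProduct.smul_tmul', smul_eq_mul, smul_eq_mul, TensorProduct.add_tmul]
  · apply tmul_symm_one_injective J e
    rw [← hδ, TensorProduct.zero_tmul]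
    -- `1 ⊗ (s·1) = s • 1`, so both `F′ψ` and `φF` fix it up to the scalar: the defect vanishes
    have hs : ((1 : A') ⊗ₜ[k] ((constToPresheaf X).app (op W) s) : A' ⊗[k] Γ(X.left, W)) =
        algebraMap k A' s • (1 : A' ⊗[k] Γ(X.left, W)) := by
      rw [← halgX, Algebra.algebraMap_eq_smul_one, TensorProduct.tmul_smul, algebraMap_smul]
      rfl
    have key := hε ((constToPresheaf X).app (op W) s)
    rw [hs, map_smul, map_smul, map_smul, map_smul, map_one, map_one, map_one, map_one, eq_comm, ← sub_eq_zero,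
      add_sub_cancel_left] at key
    exact (idealTensorIncl_injective J) (by rw [key, map_zero])

/-! ## §2 The identity on representing sections -/

include hJ hJ𝔫 in
/-- **FUNCTORIALITY OF THE OBSTRUCTION ON REPRESENTING SECTIONS, one triple overlap.**  Transition automorphisms
`ρ^X_{jl}, ρ^X_{lm}, ρ^X_{jm}` of `A' ⊗ Γ(X, W)` and `ρ^Y_{··}` of `A' ⊗ Γ(Y, W′)` (all `≡ 1 (mod 𝔫')`), their discrepancies
`ρ_lm ρ_jl ρ_jm⁻¹` REPRESENTED by `θ^X ∈ Γ(W, 𝒯_X)`, `θ^Y ∈ Γ(W′, 𝒯_Y)` (★ F2 `exists_obstructionCochain`), three lifts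
`F_j, F_l, F_m ≡ 1 ⊗ g (mod 𝔫')` intertwining them MODULO `J` pairwise with defect coordinates `δ_jl` (pair `F_j, F_l`), `δ_lm`
(`F_l, F_m`), `δ_jm` (`F_j, F_m`) as in `exists_defectCoord`.  Then for every `c ∈ Γ(X, W)`:
**`g(θ^X(dc)) = θ^Y(d(g c)) + δ_jl(c) + δ_lm(c) − δ_jm(c)`**.  Proof: ★ `obstructionDerivation_functorial₃` for the derivations
`D^X, D^Y` behind `θ^X, θ^Y` (★ `exists_eq_infinitesimalAut_iff`, ★ `rep_iff_forall_eq_tmul`), read on the coordinate `t`.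
[cite: Hartshorne2010, Thm. 10.2 (proof), p. 81] [cite: Hartshorne2010, Remark 10.1.1, p. 80] [cite: Hartshorne2010, Cor. 10.3, p. 82] -/
theorem appLE_obstruction_functorial_rep
    (ρXjl ρXlm ρXjm : A' ⊗[k] Γ(X.left, W) ≃ₐ[A'] A' ⊗[k] Γ(X.left, W))
    (ρYjl ρYlm ρYjm : A' ⊗[k] Γ(Y.left, W') ≃ₐ[A'] A' ⊗[k] Γ(Y.left, W'))
    (hρXjl : ∀ x, ρXjl x - x ∈ 𝔫' • (⊤ : Submodule A' (A' ⊗[k] Γ(X.left, W))))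
    (hρXjm : ∀ x, ρXjm x - x ∈ 𝔫' • (⊤ : Submodule A' (A' ⊗[k] Γ(X.left, W))))
    (hρYjl : ∀ x, ρYjl x - x ∈ 𝔫' • (⊤ : Submodule A' (A' ⊗[k] Γ(Y.left, W'))))
    (hρYlm : ∀ x, ρYlm x - x ∈ 𝔫' • (⊤ : Submodule A' (A' ⊗[k] Γ(Y.left, W'))))
    (hρYjm : ∀ x, ρYjm x - x ∈ 𝔫' • (⊤ : Submodule A' (A' ⊗[k] Γ(Y.left, W'))))
    (θX : (cotangentSheaf X).over W ⟶ (unitModule X.left).over W)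
    (hθX : ∀ c : Γ(X.left, W), (ρXlm * ρXjl * ρXjm⁻¹) ((1 : A') ⊗ₜ c) =
      (1 : A') ⊗ₜ c + ((e.symm 1 : ↥(J.restrictScalars k)) : A') ⊗ₜ
        (show Γ(X.left, W) from appLE θX (𝟙 W) (dSection X W c)))
    (θY : (cotangentSheaf Y).over W' ⟶ (unitModule Y.left).over W')
    (hθY : ∀ c : Γ(Y.left, W'), (ρYlm * ρYjl * ρYjm⁻¹) ((1 : A') ⊗ₜ c) =
      (1 : A') ⊗ₜ c + ((e.symm 1 : ↥(J.restrictScalars k)) : A') ⊗ₜ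
        (show Γ(Y.left, W') from appLE θY (𝟙 W') (dSection Y W' c)))
    (Fj Fl Fm : A' ⊗[k] Γ(X.left, W) →ₐ[A'] A' ⊗[k] Γ(Y.left, W'))
    (hFm : ∀ c : Γ(X.left, W), Fm ((1 : A') ⊗ₜ c) - (1 : A') ⊗ₜ g c ∈ 𝔫' • (⊤ : Submodule A' (A' ⊗[k] Γ(Y.left, W'))))
    (δjl δlm δjm : Γ(X.left, W) → Γ(Y.left, W'))
    (hjl : ∀ c, Fl (ρXjl ((1 : A') ⊗ₜ c)) =
      ρYjl (Fj ((1 : A') ⊗ₜ c)) + ((e.symm 1 : ↥(J.restrictScalars k)) : A') ⊗ₜ δjl c)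
    (hlm : ∀ c, Fm (ρXlm ((1 : A') ⊗ₜ c)) =
      ρYlm (Fl ((1 : A') ⊗ₜ c)) + ((e.symm 1 : ↥(J.restrictScalars k)) : A') ⊗ₜ δlm c)
    (hjm : ∀ c, Fm (ρXjm ((1 : A') ⊗ₜ c)) =
      ρYjm (Fj ((1 : A') ⊗ₜ c)) + ((e.symm 1 : ↥(J.restrictScalars k)) : A') ⊗ₜ δjm c)
    (hδjl : ∀ a b, δjl (a + b) = δjl a + δjl b) (hδjl' : ∀ (s : k) a, δjl (s • a) = s • δjl a)
    (hδlm : ∀ a b, δlm (a + b) = δlm a + δlm b) (hδlm' : ∀ (s : k) a, δlm (s • a) = s • δlm a)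
    (hδjm : ∀ a b, δjm (a + b) = δjm a + δjm b) (hδjm' : ∀ (s : k) a, δjm (s • a) = s • δjm a)
    (c : Γ(X.left, W)) :
    g (show Γ(X.left, W) from appLE θX (𝟙 W) (dSection X W c)) =
      (show Γ(Y.left, W') from appLE θY (𝟙 W') (dSection Y W' (g c))) + δjl c + δlm c - δjm c := by
  -- the derivations behind the two discrepancies
  have hJX : ∀ x, (ρXlm * ρXjl * ρXjm⁻¹) x - x ∈ J • (⊤ : Submodule A' (A' ⊗[k] Γ(X.left, W))) :=
    sub_mem_of_rep J e hθX
  have hJY : ∀ x, (ρYlm * ρYjl * ρYjm⁻¹) x - x ∈ J • (⊤ : Submodule A' (A' ⊗[k] Γ(Y.left, W'))) :=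
    sub_mem_of_rep J e hθY
  obtain ⟨DX, hDX⟩ := (exists_eq_infinitesimalAut_iff J hJ _).2 hJX
  obtain ⟨DY, hDY⟩ := (exists_eq_infinitesimalAut_iff J hJ _).2 hJY
  have hDXc := (rep_iff_forall_eq_tmul (X := X) J hJ e hDX θX).1 hθX
  have hDYc := (rep_iff_forall_eq_tmul (X := Y) J hJ e hDY θY).1 hθY
  -- the `k`-linear defects `ε = δ ⊗ t`
  let mkε : ∀ (δ : Γ(X.left, W) → Γ(Y.left, W')), (∀ a b, δ (a + b) = δ a + δ b) → (∀ (s : k) a, δ (s • a) = s • δ a) →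
      (Γ(X.left, W) →ₗ[k] Γ(Y.left, W') ⊗[k] ↥(J.restrictScalars k)) := fun δ hadd hsmul =>
    { toFun := fun c => δ c ⊗ₜ e.symm 1
      map_add' := fun a b => by rw [hadd, TensorProduct.add_tmul]
      map_smul' := fun s a => by rw [hsmul, RingHom.id_apply, TensorProduct.smul_tmul'] }
  have key := obstructionDerivation_functorial₃ J hJ hJ𝔫 Fj Fl Fm g hFm
    (ψ'₁₂ := ρXjl) (ψ'₂₃ := ρXlm) (ψ'₁₃ := ρXjm) (φ'₁₂ := ρYjl) (φ'₂₃ := ρYlm) (φ'₁₃ := ρYjm)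
    hρXjl hρXjm hρYjl hρYlm hρYjm (mkε δjl hδjl hδjl') (mkε δlm hδlm hδlm') (mkε δjm hδjm hδjm')
    (fun b => by rw [hjl]; change _ = _ + idealTensorIncl J (δjl b ⊗ₜ e.symm 1); rw [idealTensorIncl_tmul])
    (fun b => by rw [hlm]; change _ = _ + idealTensorIncl J (δlm b ⊗ₜ e.symm 1); rw [idealTensorIncl_tmul])
    (fun b => by rw [hjm]; change _ = _ + idealTensorIncl J (δjm b ⊗ₜ e.symm 1); rw [idealTensorIncl_tmul])
    hDX hDY c
  rw [hDXc, hDYc, LinearMap.rTensor_tmul] at key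
  change g _ ⊗ₜ e.symm 1 = _ ⊗ₜ e.symm 1 + δjl c ⊗ₜ e.symm 1 + δlm c ⊗ₜ e.symm 1 - δjm c ⊗ₜ e.symm 1 at key
  apply tmul_symm_one_injective J e
  rw [key, TensorProduct.sub_tmul, TensorProduct.add_tmul, TensorProduct.add_tmul]

end Literature.AlgebraicGeometry.Deformation

end
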